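import Summits.CriticalPhenomena.CardyFormulaZ2.Theorems.CardySelfDualSegmentUniformMarginalitySandwichGlue

/-!
# Sandwich glue of line `Sketch`, fixed-parameter form (crux `UniformMarginality`, stmt-CriticalPhenomena-5472)

Skeleton v6 of the lead's line removes the `t`-uniformity from the transport kernel altogether. The
tightness the transport needs is that of the PAIR of rectilinear approximants,
`P_t(R'',δ) − P_t(R',δ) ≤ ε` for `|t − t₀| < η₀`, and

  `P_t(R'') − P_t(R') = [P_t(R'') − P_{t₀}(R'')] + [P_{t₀}(R'') − P_{t₀}(R)] + [P_{t₀}(R) − P_{t₀}(R')] + [P_{t₀}(R') − P_t(R')]`,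

where the first and last brackets are instances of the line's other stub (B₁) — the crux on
RECTILINEAR domains, applied to `R''` and `R'` — and the middle two are DOMAIN CONTINUITY AT THE SINGLE
PARAMETER `t₀`. Hence the research kernel of the transport becomes

* (B₂a″) FIXED-PARAMETER DOMAIN CONTINUITY: for every conformal rectangle `R`, `t₀ ∈ [0,1]`, `ε > 0`
  there is `ε₀ > 0` such that every rectilinear conformal rectangle `Q`, `ε₀`-close to `R` in boundary
  loop and marks, has a mesh threshold `δ₀(Q) > 0` with `|P_{t₀}(Q,δ) − P_{t₀}(R,δ)| ≤ ε` for
  `0 < δ < δ₀` — a statement about ONE model `M_{t₀}` (at `t₀ = 0` it follows from Smirnov's theorem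
  for the sheared domains + Radó continuity of the Cardy value; at `t₀ ∈ (0,1)` it needs RSW for
  `M_{t₀}`, pointwise in `t₀`),

and the glue proved here: `stub_uniformSandwichOfFixedDomainContinuity : (B₂a″) → (B₁) → (B₂a)` (the
local uniform rectilinear sandwiches of skeleton v3), using the landed geometry `stub_mixedApproximants`
(p114647) and monotonicity `Pext_mono_of_nested` (p115057).
-/

noncomputable section

namespace Summit.CriticalPhenomena.CardyFormulaZ2.Cruxes.UniformMarginality.HeatFlow

open MeasureTheory Literature.Probability.Percolation Literature.Probability.LatticeModels
  Literature.Probability.RandomPlanarGeometry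

/-- STUB (glue) of skeleton v6 — **uniform sandwiches from fixed-parameter domain continuity and the
crux on rectilinear domains**: given `R`, `t₀`, `ε`, take `ε₀` from (B₂a″) with `ε/4`, the rectilinear
approximants `R' ≤ R ≤ R''` of `stub_mixedApproximants R ε₀` (nested crude events below `δ₁`), their
fixed-parameter thresholds `δ'`, `δ''`, and their (B₁)-moduli `η'`, `η''` at `t₀` for `ε/4`; then for
`δ < min δ₁ (min δ' δ'')` and `|t − t₀| < min η' η''` the crossing probabilities are nested
(`Pext_mono_of_nested`) and `P_t(R'') − P_t(R') ≤ 4 · ε/4`. -/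
theorem stub_uniformSandwichOfFixedDomainContinuity :
    (∀ (R : ConformalRectangle) (t₀ : ℝ), t₀ ∈ Set.Icc (0 : ℝ) 1 → ∀ ε : ℝ, 0 < ε →
      ∃ ε₀ > 0, ∀ Q : ConformalRectangle,
        (∃ S : Finset (ℂ × ℂ), (∀ p ∈ S, p.1.re = p.2.re ∨ p.1.im = p.2.im) ∧
          frontier Q.carrier ⊆ ⋃ p ∈ S, segment ℝ p.1 p.2) →
        (∀ u : ℝ, dist (Q.boundary u) (R.boundary u) ≤ ε₀) → (∀ i : Fin 4, |Q.mark i - R.mark i| ≤ ε₀) →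
        ∃ δ₀ > 0, ∀ δ : ℝ, 0 < δ → δ < δ₀ → |Pext Q δ t₀ - Pext R δ t₀| ≤ ε) →
    (∀ R : ConformalRectangle,
      (∃ S : Finset (ℂ × ℂ), (∀ p ∈ S, p.1.re = p.2.re ∨ p.1.im = p.2.im) ∧
        frontier R.carrier ⊆ ⋃ p ∈ S, segment ℝ p.1 p.2) →
      ∀ t₀ : ℝ, t₀ ∈ Set.Icc (0 : ℝ) 1 → ∀ ε > 0, ∃ η > 0,
        ∀ δ : ℝ, 0 < δ → ∀ t ∈ Set.Icc (0 : ℝ) 1, |t - t₀| < η → |Pext R δ t - Pext R δ t₀| < ε) →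
    (∀ (R : ConformalRectangle) (t₀ : ℝ), t₀ ∈ Set.Icc (0 : ℝ) 1 → ∀ ε : ℝ, 0 < ε →
      ∃ R' R'' : ConformalRectangle,
        (∃ S : Finset (ℂ × ℂ), (∀ p ∈ S, p.1.re = p.2.re ∨ p.1.im = p.2.im) ∧
          frontier R'.carrier ⊆ ⋃ p ∈ S, segment ℝ p.1 p.2) ∧
        (∃ S : Finset (ℂ × ℂ), (∀ p ∈ S, p.1.re = p.2.re ∨ p.1.im = p.2.im) ∧
          frontier R''.carrier ⊆ ⋃ p ∈ S, segment ℝ p.1 p.2) ∧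
        ∃ δ₀ > 0, ∃ η₀ > 0, ∀ δ : ℝ, 0 < δ → δ < δ₀ → ∀ t ∈ Set.Icc (0 : ℝ) 1, |t - t₀| < η₀ →
          Pext R' δ t ≤ Pext R δ t ∧ Pext R δ t ≤ Pext R'' δ t ∧ Pext R'' δ t - Pext R' δ t ≤ ε) := by
  intro hDC hB₁ R t₀ ht₀ ε hε
  have hε4 : 0 < ε / 4 := by positivity
  obtain ⟨ε₀, hε₀, hclose⟩ := hDC R t₀ ht₀ (ε / 4) hε4
  obtain ⟨R', R'', hS', hS'', hb', hm', hb'', hm'', δ₁, hδ₁, hnest⟩ :=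
    stub_mixedApproximants R ε₀ hε₀
  obtain ⟨δ', hδ', h'⟩ := hclose R' hS' hb' hm'
  obtain ⟨δ'', hδ'', h''⟩ := hclose R'' hS'' hb'' hm''
  obtain ⟨η', hη', hB'⟩ := hB₁ R' hS' t₀ ht₀ (ε / 4) hε4
  obtain ⟨η'', hη'', hB''⟩ := hB₁ R'' hS'' t₀ ht₀ (ε / 4) hε4
  refine ⟨R', R'', hS', hS'', min δ₁ (min δ' δ''), lt_min hδ₁ (lt_min hδ' hδ''),
    min η' η'', lt_min hη' hη'', ?_⟩
  intro δ hδ hδlt t ht htt₀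
  have hδ₁' : δ < δ₁ := hδlt.trans_le (min_le_left _ _)
  have hδ'lt : δ < δ' := hδlt.trans_le ((min_le_right _ _).trans (min_le_left _ _))
  have hδ''lt : δ < δ'' := hδlt.trans_le ((min_le_right _ _).trans (min_le_right _ _))
  have hη'lt : |t - t₀| < η' := htt₀.trans_le (min_le_left _ _)
  have hη''lt : |t - t₀| < η'' := htt₀.trans_le (min_le_right _ _)
  have hlo : Pext R' δ t ≤ Pext R δ t :=
    Pext_mono_of_nested (fun ω hω hωc => (hnest δ hδ hδ₁' ω hω).1 hωc) t
  have hhi : Pext R δ t ≤ Pext R'' δ t :=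
    Pext_mono_of_nested (fun ω hω hωc => (hnest δ hδ hδ₁' ω hω).2 hωc) t
  have h1 := h' δ hδ hδ'lt            -- |P_{t₀}(R') − P_{t₀}(R)| ≤ ε/4
  have h2 := h'' δ hδ hδ''lt          -- |P_{t₀}(R'') − P_{t₀}(R)| ≤ ε/4
  have h3 := hB' δ hδ t ht hη'lt      -- |P_t(R') − P_{t₀}(R')| < ε/4
  have h4 := hB'' δ hδ t ht hη''lt    -- |P_t(R'') − P_{t₀}(R'')| < ε/4
  refine ⟨hlo, hhi, ?_⟩
  rw [abs_le] at h1 h2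
  rw [abs_lt] at h3 h4
  linarith [h1.1, h2.2, h3.1, h4.2]

end Summit.CriticalPhenomena.CardyFormulaZ2.Cruxes.UniformMarginality.HeatFlow

end
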